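import Literature.NumberTheory.LFunctions.Zhang2022.RepairRplus

/-!
# Zhang (2022) §18-margin repair rung — TIGHTNESS of the first barrier extension `not_repairable_in_Rplus`:
# the displayed E*-slot of the two-piece verdict is load-bearing at every length `θ > 1`

Trunk T-ANT (NumberTheory/LFunctions). Y. Zhang, *Discrete mean estimates and the Landau–Siegel
zero*, arXiv:2211.02515v1 (2022) [Zhang2022LandauSiegel] — **an unrefereed manuscript under
adjudication. WHAT THIS IS NOT: nothing here asserts or denies its Theorems 1–2 or any analytic lemma;
no claim about Landau–Siegel zeros, about Parity, or about a repaired `Margin232` is made.** Cell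
`landau-siegel` (rung F-S3), sub-cell E (barrier extension), seat p1; companion of `RepairRplus`
(`Repair.not_repairable_in_Rplus`, the first extension theorem, class `R⁺`).

## What this file proves

The two-piece part of `Repair.not_repairable_in_Rplus` reads: for a smooth two-piece design `s·u ⊕ v` of
any length `θ ≥ 1` (`Repair.InRplus (.twoPiece θ u u′ v v′ s)`), **in every off-diagonal world `X` with
`KnifeEdge.InvisibleOverhang θ X`** the main-order constant `KnifeEdge.twoPieceMainTerm θ X u u′ v v′ s`
is not negative. The invisibility of the world is a DISPLAYED E*-slot (REF-E C3(c)), not a consequence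
of class membership. This file shows that the slot cannot be dropped: in the CONTINUED CALCULUS — the
world `X = 0`, "no off-diagonal main term beyond `P`", which nobody asserts — the class member
`g⋆ ⊕ φ_θ` (`KnifeEdge.inClassPiece_gStar`, `KnifeEdge.overhangPiece_phiT`; in `R⁺` by
`Repair.inRplus_gStar_phiT`) closes by positivity at EVERY `θ > 1`:

* `mainTermForm_gStar` — the kernel mode `g⋆` has `𝔅(g⋆) = 0` (`Repair.mainTermForm_gCore` transported
  along `mainTermForm_congr_ae`);
* `twoPieceMainTerm_zero_gStar_phiT` — for real `s`,
  `twoPieceMainTerm θ 0 g⋆ g⋆′ φ_θ φ_θ′ s = 48·π·Φ(θ)·s + Re 𝔅_θ(φ_θ)` with `Φ(θ) = (θ−1)³/6`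
  (`Repair.phiInt`; rank-one tail coupling `KnifeEdge.MformTop_gStar_phiT`: cross term `24πΦ`);
* `twoPieceMainTerm_zero_eq_neg_one` — for `θ > 1` the real weight
  `s = −(Re 𝔅_θ(φ_θ) + 1)/(48πΦ(θ))` gives the constant `−1` (this is `Repair.topForm_indefinite` re-read in
  the two-piece currency), hence `closesByPositivity_zero : 1 < θ → KnifeEdge.ClosesByPositivity θ 0`;
* `not_invisibleOverhang_zero` — `1 < θ → ¬ KnifeEdge.InvisibleOverhang θ 0`
  (`KnifeEdge.not_closes_of_invisible`): the continued calculus is NOT an invisible world beyond `P`;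
* `inRplus_twoPiece_closes_without_slot` — an `R⁺`-member violates the un-slotted verdict at every
  `θ > 1`: `∃ s, InRplus (.twoPiece θ g⋆ g⋆′ φ_θ φ_θ′ s) ∧ twoPieceMainTerm θ 0 g⋆ g⋆′ φ_θ φ_θ′ s < 0`, and
  `not_noMainOrderClosing_without_slot` — the verdict shape with the slot deleted
  (`∀ X, ¬ (twoPieceMainTerm … < 0)`) is FALSE on that member; `noMainOrderClosing_gStar_phiT` records,
  for contrast, the verdict of record WITH the slot on the same member.

So the first extension is sharp on its two-piece part: closing inside `R⁺ \ R̄` is exactly the question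
whether the true off-diagonal world is invisible (registry E-002, E*-len⁺(X)); the theorem
`not_repairable_in_Rplus` neither hides nor idles that hypothesis. CURRENCY (REF-E C3(e)): every
statement here is about the continued-calculus constant `twoPieceMainTerm` (formula I continued past `P`,
`Repair.MformTop θ`), not about (A)-world main terms off `R` (registry E-017 open).

Elementary over the landed kit; theorems only (no `def`, no new `Prop` fact), standard axioms.

## References

* Y. Zhang, arXiv:2211.02515v1 (2022), §7 Prop. 7.1, (7.2) [p. 44], §8 (8.11)–(8.12).
  [cite: Zhang2022LandauSiegel, §7 (7.2) p.44; §8 (8.11)–(8.12)]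
-/

noncomputable section

open Real Complex ComplexConjugate Set
open _root_.MeasureTheory

namespace Literature.NumberTheory.LFunctions.Zhang2022

namespace Repair

open KnifeEdge

variable {θ : ℝ}

/-! ### The kernel mode `g⋆` is `𝔅`-null -/

/-- `𝔅(g⋆) = 0`: the kernel mode `g⋆ = (e^{−iπy} + e^{−2iπy})|_{[0,1]}` agrees with `gCore` on `[0,1]` and its
marked right derivative agrees with `gCore′` on `[0,1)`, so `mainTermForm_congr_ae` transports
`Repair.mainTermForm_gCore`. [cite: Zhang2022LandauSiegel, §7 Prop 7.1 p.44, (7.2)] -/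
theorem mainTermForm_gStar : mainTermForm gStar gStar' = 0 := by
  rw [← mainTermForm_gCore]
  refine mainTermForm_congr_ae (fun y hy => gStar_of_le hy.2) ?_
  rw [← Measure.restrict_congr_set (Ioo_ae_eq_Ioc (μ := volume))]
  filter_upwards [ae_restrict_mem measurableSet_Ioo] with y hy using gStar'_of_lt hy.2

/-! ### The two-piece constant of `g⋆ ⊕ φ_θ` in the continued calculus `X = 0` -/

/-- In the world `X = 0` the two-piece constant of `s·g⋆ ⊕ φ_θ` (`s` real, `θ ≥ 1`) is
`48·π·Φ(θ)·s + Re 𝔅_θ(φ_θ)`, `Φ(θ) = (θ−1)³/6`: in-class block `|s|²𝔅(g⋆) = 0`, cross block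
`2Re(s·π·Φ̄·L(g⋆)) = 2·s·π·Φ·24` (`L(g⋆) = 24`, `Φ(φ_θ) = Repair.phiInt θ`), overhang block `Re 𝔅_θ(φ_θ)`.
[cite: Zhang2022LandauSiegel, §7 Prop 7.1 p.44, (7.2); §8 (8.11)–(8.12)] -/
theorem twoPieceMainTerm_zero_gStar_phiT (hθ : 1 ≤ θ) (s : ℝ) :
    twoPieceMainTerm θ 0 gStar gStar' (phiT θ) (phiT' θ) (s : ℂ)
      = 48 * π * phiInt θ * s + (topDiagForm θ (phiT θ) (phiT' θ)).re := by
  unfold twoPieceMainTerm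
  rw [mainTermForm_gStar, overhangMass_phiT hθ, tailFunctional_gStar]
  have e1 : ((s : ℂ) * ((π : ℂ) * conj (((phiInt θ : ℝ) : ℂ)) * 24 + (0 : PairFunctional) gStar gStar'
      (phiT θ) (phiT' θ))) = ((s * (π * phiInt θ * 24) : ℝ) : ℂ) := by
    rw [Pi.zero_apply, Pi.zero_apply, Pi.zero_apply, Pi.zero_apply, Complex.conj_ofReal]
    push_cast
    ring
  have e2 : ((0 : PairFunctional) (phiT θ) (phiT' θ) (phiT θ) (phiT' θ)) = 0 := rfl
  rw [e1, e2, Complex.ofReal_re, Complex.zero_re]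
  ring

/-! ### The continued calculus closes by positivity beyond `P`; the E*-slot is load-bearing -/

/-- `Φ(θ) = (θ−1)³/6 > 0` for `θ > 1`. [cite: Zhang2022LandauSiegel, §7 (7.2) p.44] -/
theorem phiInt_pos (hθ : 1 < θ) : 0 < phiInt θ := by
  unfold phiInt
  exact div_pos (pow_pos (sub_pos.2 hθ) 3) (by norm_num)

/-- **The value `−1` is reached in the world `X = 0` at every `θ > 1`**: with the real weight
`s = −(Re 𝔅_θ(φ_θ) + 1)/(48πΦ(θ))` the two-piece constant of `s·g⋆ ⊕ φ_θ` is `−1`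
(`Repair.topForm_indefinite` in the currency of `KnifeEdge.twoPieceMainTerm`).
[cite: Zhang2022LandauSiegel, §7 Prop 7.1 p.44, (7.2)] -/
theorem twoPieceMainTerm_zero_eq_neg_one (hθ : 1 < θ) :
    ∃ s : ℝ, twoPieceMainTerm θ 0 gStar gStar' (phiT θ) (phiT' θ) (s : ℂ) = -1 := by
  set q : ℝ := (topDiagForm θ (phiT θ) (phiT' θ)).re with hq
  refine ⟨-(q + 1) / (48 * π * phiInt θ), ?_⟩
  rw [twoPieceMainTerm_zero_gStar_phiT hθ.le, ← hq]
  have hΦ : 0 < phiInt θ := phiInt_pos hθ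
  have hπ : 0 < π := Real.pi_pos
  have h48 : 48 * π * phiInt θ ≠ 0 := by positivity
  field_simp
  ring

/-- **An `R⁺`-member violates the un-slotted two-piece verdict at every `θ > 1`**: some `s·g⋆ ⊕ φ_θ` of class
`R⁺` (`Repair.inRplus_gStar_phiT`) has a NEGATIVE two-piece constant in the world `X = 0`.
[cite: Zhang2022LandauSiegel, §7 Prop 7.1 p.44, (7.2)] -/
theorem inRplus_twoPiece_closes_without_slot (hθ : 1 < θ) :
    ∃ s : ℂ, InRplus (.twoPiece θ gStar gStar' (phiT θ) (phiT' θ) s) ∧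
      twoPieceMainTerm θ 0 gStar gStar' (phiT θ) (phiT' θ) s < 0 := by
  obtain ⟨s, hs⟩ := twoPieceMainTerm_zero_eq_neg_one hθ
  exact ⟨(s : ℂ), inRplus_gStar_phiT hθ.le _, by rw [hs]; norm_num⟩

/-- **The world `X = 0` closes by positivity at every `θ > 1`** (`KnifeEdge.ClosesByPositivity θ 0`): the
length knife edge `θ_max = 1` of the continued calculus, in the two-piece currency.
[cite: Zhang2022LandauSiegel, §7 Prop 7.1 p.44, (7.2)] -/
theorem closesByPositivity_zero (hθ : 1 < θ) : ClosesByPositivity θ 0 := by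
  obtain ⟨s, hmem, hlt⟩ := inRplus_twoPiece_closes_without_slot hθ
  exact ⟨gStar, gStar', phiT θ, phiT' θ, s, hmem.2.1, hmem.2.2, hlt⟩

/-- **The continued calculus is not an invisible world beyond `P`**: `¬ InvisibleOverhang θ 0` for every
`θ > 1` (`KnifeEdge.not_closes_of_invisible` contraposed with `closesByPositivity_zero`).
[cite: Zhang2022LandauSiegel, §7 Prop 7.1 p.44, (7.2)] -/
theorem not_invisibleOverhang_zero (hθ : 1 < θ) : ¬ InvisibleOverhang θ 0 :=
  fun h => not_closes_of_invisible h (closesByPositivity_zero hθ)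

/-- **The E*-slot of `NoMainOrderClosing (.twoPiece …)` is load-bearing**: deleting the hypothesis
`InvisibleOverhang θ X` from the two-piece verdict of `Repair.not_repairable_in_Rplus` gives a statement
(`∀ X, ¬ (twoPieceMainTerm θ X u u′ v v′ s < 0)`) that FAILS on a member of `R⁺` at every `θ > 1`.
[cite: Zhang2022LandauSiegel, §7 Prop 7.1 p.44, (7.2)] -/
theorem not_noMainOrderClosing_without_slot (hθ : 1 < θ) :
    ∃ s : ℂ, InRplus (.twoPiece θ gStar gStar' (phiT θ) (phiT' θ) s) ∧
      ¬ (∀ X : PairFunctional, ¬ (twoPieceMainTerm θ X gStar gStar' (phiT θ) (phiT' θ) s < 0)) := by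
  obtain ⟨s, hmem, hlt⟩ := inRplus_twoPiece_closes_without_slot hθ
  exact ⟨s, hmem, fun h => h 0 hlt⟩

/-- … while WITH the slot the verdict of record holds on the same member (an instance of
`Repair.not_repairable_in_Rplus`, recorded next to the failure for contrast): in every invisible world the
constant of `s·g⋆ ⊕ φ_θ` is not negative, for every `θ ≥ 1` and every `s`.
[cite: Zhang2022LandauSiegel, §7 Prop 7.1 p.44, (7.2)] -/
theorem noMainOrderClosing_gStar_phiT (hθ : 1 ≤ θ) (s : ℂ) :
    NoMainOrderClosing (.twoPiece θ gStar gStar' (phiT θ) (phiT' θ) s) :=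
  not_repairable_in_Rplus _ (inRplus_gStar_phiT hθ s)

end Repair

end Literature.NumberTheory.LFunctions.Zhang2022
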